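/-
Copyright (c) 2026 the pub-hodgecm-mathlib formalisation cell (harness21).  Prover seat hodgecm-mathlib-LH4-p04 (g0), req620 Track A «(D-RAM) FOUR-FRAME» squad
(unit U3_Laws, stubs `stub_U3_stableLaw_RP ∕ _RU`; LH4-p11 (g0) (S)-side TARGET C «CORE UNIQUENESS», signature of 2026-09-03 22:05:13Z verbatim; dealer LH4-plan (g10)
WORD #36 (3), LH4-p02 (g12) 22:12:30Z «C stays with p04»).  2026-09-03.
-/
import Summits.HodgeConjecture.HodgeConjecture.Theorems.F0P3cDyRamDiagonalSubBuildingSlot   -- ★ p855155 (LH4-p10 (g0)) TARGET D: `single_mem_and_v_le_of_isVertexLattice_diagonal` (one slot); brings ★ `UnitaryLatticeTreeTypes`∕`Dual`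
import Literature.NumberTheory.Automorphic.UnitaryLatticeTreeApartment                     -- ★ `type_unique`, `isSelfDualLattice_stdLattice`
import HarnessLib

/-!
# Crux `H413`, line LH4 «(D-RAM) FOUR-FRAME» road — unit U3_Laws (iii), TIER 2 SUPPORT: CORE UNIQUENESS in the unimodular diagonal model
# (the only totally split vertex is the root `𝒪³`, of type `0`)

Cell `hodgecm-mathlib` (D-0151), FLOOR 0, crux item H413 = `stmt-HodgeConjecture-24833`, route of record `HCCMUnconditional`; squad F0∕P3c∕LH4 (req618∕req620).  THEOREMS ONLY
(no `def`, no instance, no notation, no `sorry`, default heartbeats); lane `--supports stmt-HodgeConjecture-24833 --as helper` (count-neutral).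

WHAT IS PROVED (rank `3`, any valued field `K`, `σ` valuation-preserving, `|ϖ| = exp(−1)`).  In the diagonal model of a frame (★ p855032: form `diag(d)` with UNIT entries
`|d_i| = 1`, frame projections = the coordinate idempotents `E_ii`), a vertex lattice `M` (★ `IsVertexLattice σ ϖ (diag d) t M`, any type `t`) which is SPLIT AT EVERY SLOT
(`x ∈ M ⇒ x_i·e_i ∈ M` for `i = 0, 1, 2`, i.e. `M ∈ B₀ ∩ B₁ ∩ B₂`) IS the root: `M = 𝒪³ = stdLattice K 3` and `t = 0`.  In tree language: the three sub-buildings `B_i` of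
`E_ii`-stable vertices meet in the single CORE vertex `Λ_C` — the centre of LH4-p11 (g0)'s (S) structure DATUM §5 (the three fixed half-lines `B_i ∩ Fix` emanate from it).
PROOF.  ★ TARGET D `single_mem_and_v_le_of_isVertexLattice_diagonal` at each slot gives `e_i ∈ M` and `|x_i| ≤ 1` on `M`; hence `M ≤ 𝒪³` coordinatewise and `𝒪³ = Σ 𝒪·e_i ≤ M`;
the root `𝒪³` is a self-dual (type-`0`) vertex of the unimodular form `diag(d)` (★ `isSelfDualLattice_stdLattice`), and the type of a vertex is unique (★ `type_unique`), so `t = 0`.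
* `isIntMatrix_diagonal_of_v_le`, `isIntMatrix_diagonal_inv_of_v_eq_one`, `v_det_diagonal_eq_one` — the unimodular diagonal form (§1);
* **`eq_stdLattice_of_isVertexLattice_diagonal_of_forall_single_mem`** — TARGET C token for token (§2).
HONEST LABEL.  Count-neutral; nothing printed is asserted; the census laws stay PROVER TARGETS; `HC_CM` is proved only modulo the 7 printed citations (2 remaining named inputs:
hLiu418 = `stmt-HodgeConjecture-24832`, h413 = `stmt-HodgeConjecture-24833`) until rung 0 closes.

## References
* [Jacobowitz1962] R. Jacobowitz, *Hermitian forms over local fields*, Amer. J. Math. 84 (1962) 441–465, §4, §7 (unimodular lattices, the standard lattice).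
* [BruhatTits1972] F. Bruhat, J. Tits, *Groupes réductifs sur un corps local I*, Publ. Math. IHÉS 41 (1972), §10 (vertices and their types).
* [Serre1980Trees] J.-P. Serre, *Trees*, Springer (1980), Ch. II §1.1 (lattices and the action of diagonal elements).
* [Rogawski1990] J. D. Rogawski, *Automorphic Representations of Unitary Groups in Three Variables*, Ann. of Math. Stud. 123 (1990), §4.9 Prop. 4.9.1 (a) p. 55.
-/

set_option autoImplicit false

noncomputable section

namespace Summit.HodgeConjecture.HodgeConjecture.Cruxes.H413.F0P3cDyRamDiagonalCoreUnique

open Matrix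
open Literature.NumberTheory.Automorphic Literature.NumberTheory.Automorphic.HermitianLattice Literature.NumberTheory.Automorphic.UnitaryGroup
open Literature.NumberTheory.Automorphic.UnitaryLatticeTree
open Summit.HodgeConjecture.HodgeConjecture.Cruxes.H413.F0P3cDyRamDiagonalSubBuildingSlot (single_mem_and_v_le_of_isVertexLattice_diagonal)
open scoped Valued WithZero Matrix MatrixGroups

/-! ## §1  The unimodular diagonal form -/

section Form

variable {K : Type*} [Field K] [Valued K ℤᵐ⁰] {d : Fin 3 → K}

/-- `diag(d)` is integral when `|d_i| ≤ 1`. [cite: Jacobowitz1962, §4] -/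
theorem isIntMatrix_diagonal_of_v_le (hd : ∀ i, Valued.v (d i) ≤ 1) : IsIntMatrix (Matrix.diagonal d) := by
  intro i j
  by_cases hij : i = j
  · subst hij; rw [Matrix.diagonal_apply_eq]; exact hd i
  · rw [Matrix.diagonal_apply_ne _ hij, map_zero]; exact zero_le

/-- `diag(d)⁻¹ = diag(d⁻¹)` is integral when `|d_i| = 1`. [cite: Jacobowitz1962, §4] -/
theorem isIntMatrix_diagonal_inv_of_v_eq_one (hd : ∀ i, Valued.v (d i) = 1) : IsIntMatrix (Matrix.diagonal d)⁻¹ := by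
  have hd0 : ∀ i, d i ≠ 0 := fun i h => by have := hd i; rw [h, map_zero] at this; exact zero_ne_one this
  have hinv : (Matrix.diagonal d)⁻¹ = Matrix.diagonal fun i => (d i)⁻¹ :=
    Matrix.inv_eq_left_inv (by
      rw [Matrix.diagonal_mul_diagonal, ← Matrix.diagonal_one]
      congr 1; funext i; exact inv_mul_cancel₀ (hd0 i))
  rw [hinv]
  exact isIntMatrix_diagonal_of_v_le fun i => by rw [map_inv₀, hd i, inv_one]

/-- `|det diag(d)| = 1` when `|d_i| = 1`. [cite: Jacobowitz1962, §7] -/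
theorem v_det_diagonal_eq_one (hd : ∀ i, Valued.v (d i) = 1) : Valued.v (Matrix.diagonal d).det = 1 := by
  rw [Matrix.det_diagonal, map_prod]
  exact Finset.prod_eq_one fun i _ => hd i

end Form

/-! ## §2  The head -/

section Head

/-- **HEAD — CORE UNIQUENESS** (LH4-p11 (g0) TARGET C): for `σ` valuation-preserving, `|ϖ| = exp(−1)`, a unit diagonal form `diag(d)` (`|d_i| = 1`) and a vertex lattice `M` of
`(K³, diag d)` of any type `t` which is split at EVERY slot (`x ∈ M ⇒ x_i e_i ∈ M`, `i = 0, 1, 2`): `M = stdLattice K 3` (the root `𝒪³`) and `t = 0`.  ★ TARGET D at each slot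
gives `e_i ∈ M` and `|x_i| ≤ 1` on `M`, so `M = Σ_i 𝒪 e_i = 𝒪³`; the root is self-dual for the unimodular `diag(d)` (★ `isSelfDualLattice_stdLattice`) and vertex types are
unique (★ `type_unique`).  The three sub-buildings `B_i` meet in this single core vertex. [cite: Jacobowitz1962, §4, §7] [cite: BruhatTits1972, §10] [cite: Serre1980Trees, II §1.1]
[cite: Rogawski1990, §4.9 Prop. 4.9.1 (a) p. 55] -/
theorem eq_stdLattice_of_isVertexLattice_diagonal_of_forall_single_mem {K : Type*} [Field K] [Valued K ℤᵐ⁰] {σ : K →+* K}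
    (hvσ : ∀ a, Valued.v (σ a) = Valued.v a) {ϖ : K} (hϖ : Valued.v ϖ = WithZero.exp (-1 : ℤ)) {d : Fin 3 → K} (hd : ∀ i, Valued.v (d i) = 1)
    {t : ℕ} {M : Submodule 𝒪[K] (Fin 3 → K)} (hM : IsVertexLattice σ ϖ (Matrix.diagonal d) t M)
    (hsplit : ∀ i, ∀ x ∈ M, (Pi.single i (x i) : Fin 3 → K) ∈ M) : M = stdLattice K 3 ∧ t = 0 := by
  -- TARGET D at every slot: `e_i ∈ M` and `|x_i| ≤ 1` on `M`
  have hslot : ∀ i : Fin 3, (Pi.single i 1 : Fin 3 → K) ∈ M ∧ ∀ x ∈ M, Valued.v (x i) ≤ 1 :=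
    fun i => single_mem_and_v_le_of_isVertexLattice_diagonal hvσ hϖ hd hM i (hsplit i)
  -- `M = 𝒪³`
  have hMeq : M = stdLattice K 3 := by
    refine le_antisymm (fun x hx => mem_stdLattice.2 fun j => (hslot j).2 x hx) (fun x hx => ?_)
    have hx' : ∀ j, Valued.v (x j) ≤ 1 := fun j => mem_stdLattice.1 hx j
    rw [← Finset.univ_sum_single x]
    refine M.sum_mem fun i _ => ?_
    have hmem := M.smul_mem (⟨x i, hx' i⟩ : 𝒪[K]) (hslot i).1
    have heq : ((⟨x i, hx' i⟩ : 𝒪[K]) • (Pi.single i (1 : K) : Fin 3 → K)) = Pi.single i (x i) := by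
      change (x i : K) • (Pi.single i (1 : K) : Fin 3 → K) = Pi.single i (x i)
      rw [← Pi.single_smul, smul_eq_mul, mul_one]
    rwa [heq] at hmem
  refine ⟨hMeq, ?_⟩
  -- `t = 0`: the root is a self-dual vertex of the unimodular `diag(d)`, and the type is unique
  have hϖ1 : Valued.v ϖ ≤ 1 := by
    rw [hϖ, ← WithZero.exp_zero]
    exact (WithZero.exp_lt_exp.2 (by norm_num)).le
  have h0 : IsVertexLattice σ ϖ (Matrix.diagonal d) 0 M := by
    rw [hMeq]
    exact isSelfDualLattice_stdLattice (isIntMatrix_diagonal_of_v_le fun i => (hd i).le) (isIntMatrix_diagonal_inv_of_v_eq_one hd)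
      (v_det_diagonal_eq_one hd) hϖ1
  exact type_unique hvσ hϖ hM h0

end Head

end Summit.HodgeConjecture.HodgeConjecture.Cruxes.H413.F0P3cDyRamDiagonalCoreUnique

end
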